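import Summits.HodgeConjecture.HodgeConjecture.Theses.EightfoldTwistedSheafSeeds
import Summits.HodgeConjecture.HodgeConjecture.Theses.EightfoldBlochSeeds
import Summits.HodgeConjecture.HodgeConjecture.Theses.FirstOrderSemiregularSeeds
import Summits.HodgeConjecture.HodgeConjecture.Theses.CYFormCasimir
import Summits.HodgeConjecture.HodgeConjecture.Theorems.EightfoldBlochSeedsReachHyperbolicRiemannRealisableStubs
import Summits.HodgeConjecture.HodgeConjecture.Theorems.EightfoldBlochSeedsDefs
import Summits.HodgeConjecture.HodgeConjecture.Theorems.Ring2AbelianAllWeilSimilarDiscriminant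
import Literature.AlgebraicGeometry.HodgeTheory.WeilFamilyReachSimilarOfSystem
import Literature.AlgebraicGeometry.HodgeTheory.WeilFamilyReachSimilar
import Literature.AlgebraicGeometry.HodgeTheory.WeilFamilyReach
import Literature.AlgebraicGeometry.HodgeTheory.WeilTypeAbelianVariety
import Literature.AlgebraicGeometry.HodgeTheory.WeilClassesRationalPlane
import Literature.AlgebraicGeometry.VanGeemen1994.WeilDiscriminantOfHyperbolic
import HarnessLib

/-!
# Route `EightfoldBlochSeeds`, crux `ReachHyperbolic` (item stmt-HodgeConjecture-18883), line `moduli-riemann`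
# (`Cruxes/ReachHyperbolic/Lines/moduli_riemann.lean` 1ba65e5152037605): the remaining stub `stub_moduliComplete : ModuliCompletePackage`
# is EQUIVALENT to the full period-surjective package, and ALONE gives the crux BY NAME (Riemann half discharged)

HONEST FRAMING. Nothing here proves `stub_moduliComplete` (fine PEL moduli with level structure, universal family, flat Weil sections,
complete for realisable periods — [MumfordFogartyKirwan1994] Thm. 7.9–7.10, [Deligne1982HodgeCycles] proof of Thm. 4.8: the tree has no
moduli space of abelian varieties), nor the crux `ReachHyperbolic`, rung H2, HC_AV or HC. UNCONDITIONAL `--supports` lemmas and two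
CONDITIONAL closures (hypothesis = the registered stub's statement `ModuliCompletePackage`, credited to nothing). No definition, no named
fact (D-0026); census-neutral.

WHAT IS HERE (leafhand `leafhand-hodge-eightfoldblochseed-3-g0`, refill order 2026-08-30T22:31:52Z (1)). In `Theorems/` vocabulary
(`Theorems.EightfoldBlochSeeds.PeriodPackage` / `ModuliCompletePackage` / `RiemannRealisableAt`, VERBATIM the skeleton's, file
`EightfoldBlochSeedsDefs.lean` §1–§2):

* `moduliCompletePackage_of_periodPackage` — weakening (drop the realisability hypothesis of clause [U]).
* `periodPackage_of_moduliCompletePackage_of_riemannRealisable` — the skeleton's glue `periodPackage_of` (same proof, modus ponens inside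
  the existential).
* `periodPackage_of_moduliCompletePackage`, `moduliCompletePackage_iff_periodPackage` — UNCONDITIONAL: Riemann's existence theorem at Weil
  type is the tree theorem `Theorems.stub_riemannRealisable` (landed by name, p817932, proof `exists_realisedBy_of_isWeilComplexStructure`),
  so the registered algebraic stub IS ALREADY the whole period-surjective package — the «complete for REALISABLE periods» weakening of
  clause [U] buys nothing any more; whoever proves the stub proves period surjectivity outright.
* `weilFamilyReach_hyperbolic_of_periodPackage` — the skeleton's bridge `hyperbolic_of_periodPackage` (the venture's
  `weilFamilyReach_hyperbolic_of_polarizedWeilSystems_of_periodSurjective`, re-proved from Literature theorems: hyperbolic members are of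
  Weil type, `isWeilType_of_isHyperbolicWeilType`; lie in the split discriminant class, `hasWeilDiscriminantNondeg_neg_one_pow_of_isHyperbolicWeilType`;
  carry a non-zero rational Weil class, `exists_isRationalClass_ne_zero_mem_weilClassesOf`; and
  `weilFamilyReaches_of_polarizedWeilSystemAt_of_periodSurjective`).
* `weilFamilyReach_hyperbolic_of_moduliCompletePackage`, `reachHyperbolic_twisted_of_moduliCompletePackage`,
  `reachHyperbolic_of_moduliCompletePackage` — **the stub ALONE ⟹ `Theses.EightfoldTwistedSheafSeeds.ReachHyperbolic` and
  `Theses.EightfoldBlochSeeds.ReachHyperbolic` BY NAME**: the skeleton's composition `ReachHyperbolic_of` with its transcendental stub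
  discharged, in importable form — the by-name closure of item 18883 is `reachHyperbolic_of_moduliCompletePackage stub_moduliComplete` once
  `theorem stub_moduliComplete : ModuliCompletePackage` lands in `Theorems/`.

REMAINING (repair census, unchanged): `ModuliCompletePackage` itself = Deligne's universal PEL family with level `n ≥ 3` through every
Weil-type point, with flat Weil sections ([vanGeemen1994HodgeAV] 5.8–5.11) and period surjectivity ([Deligne1982HodgeCycles] pp. 48–51);
in the tree it is implied by the ONE named unproved Literature fact `deligne1982_weilFamily_periodConstructionAtWeilType` only through the
crux (`Theorems.reachHyperbolic_of_deligne1982_weilFamily_periodConstructionAtWeilType`, p817303); XXL, genuinely absent (no moduli of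
abelian varieties, no universal abelian scheme, no Baily–Borel).

[cite: Deligne1982HodgeCycles, §4 Cor. 4.2, Prop. 4.4, proof of Thm. 4.8 (pp. 47–52) and Rem. 4.9] [cite: vanGeemen1994HodgeAV, Lemma 5.2, (5.4.1), 5.8–5.11]
[cite: MumfordFogartyKirwan1994, Thm. 7.9–7.10] [cite: DeligneMilne1982Tannakian, art. II §6 Thm. 6.20]
-/

noncomputable section

-- single-problem summit (Problem = Summit): the mandated namespace repeats `HodgeConjecture`.
set_option linter.dupNamespace false

open CategoryTheory AlgebraicGeometry
open scoped TensorProduct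
open Literature.AlgebraicGeometry Literature.AlgebraicGeometry.Motives Literature.AlgebraicGeometry.HodgeTheory
open Literature.AlgebraicGeometry.VanGeemen1994
open Literature.AlgebraicTopology.SingularHomology
open Summit.HodgeConjecture.HodgeConjecture.Ring2.AbelianAll
open Summit.HodgeConjecture.HodgeConjecture.Theorems.EightfoldBlochSeeds


namespace Summit.HodgeConjecture.HodgeConjecture.Theorems

/-- Weakening: a period-surjective package is complete for realisable periods (drop the realisability hypothesis).
[cite: Deligne1982HodgeCycles, §4 proof of Thm. 4.8] -/
theorem moduliCompletePackage_of_periodPackage (h : PeriodPackage) : ModuliCompletePackage := by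
  intro n d hn hd P ψ₀ e a hP ha ha0 hWT
  obtain ⟨𝒳, S, f, s₀, e', Y, Ψ, ε, H, h1, h2, h3, h4, h5, h6, h7, h8, h9, m, hm, hPm, hd', hψ, ω, hω, hω0, hU⟩ :=
    h n d hn hd P ψ₀ e a hP ha ha0 hWT
  exact ⟨𝒳, S, f, s₀, e', Y, Ψ, ε, H, h1, h2, h3, h4, h5, h6, h7, h8, h9, m, hm, hPm, hd', hψ, ω, hω, hω0,
    fun J hW _ => hU J hW⟩

/-- GLUE (the skeleton's `periodPackage_of`, same proof): moduli-complete ∧ Riemann-realisable ⟹ the period-surjective package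
(modus ponens inside the existential). [cite: Deligne1982HodgeCycles, §4 proof of Thm. 4.8] -/
theorem periodPackage_of_moduliCompletePackage_of_riemannRealisable (hM : ModuliCompletePackage)
    (hR : ∀ (n d : ℕ), 1 ≤ n → 1 ≤ d → RiemannRealisableAt n d) : PeriodPackage := by
  intro n d hn hd P ψ₀ e a hP ha ha0 hWT
  obtain ⟨𝒳, S, f, s₀, e', Y, Ψ, ε, H, h1, h2, h3, h4, h5, h6, h7, h8, h9, m, hm, hPm, hd', hψ, ω, hω, hω0, hU⟩ :=
    hM n d hn hd P ψ₀ e a hP ha ha0 hWT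
  exact ⟨𝒳, S, f, s₀, e', Y, Ψ, ε, H, h1, h2, h3, h4, h5, h6, h7, h8, h9, m, hm, hPm, hd', hψ, ω, hω, hω0,
    fun J hW => hU J hW (hR n d hn hd P ψ₀ e a hP ha ha0 hWT hm hPm hd' hψ hω hω0 J hW)⟩

/-- UNCONDITIONAL converse: since Riemann's existence theorem at Weil type is a tree theorem (`stub_riemannRealisable`,
landed by name), the moduli-complete package already IS the period-surjective package. [cite: DeligneMilne1982Tannakian, art. II §6 Thm. 6.20] -/
theorem periodPackage_of_moduliCompletePackage (hM : ModuliCompletePackage) : PeriodPackage :=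
  periodPackage_of_moduliCompletePackage_of_riemannRealisable hM stub_riemannRealisable

/-- **The registered stub `stub_moduliComplete : ModuliCompletePackage` is EQUIVALENT to the full period-surjective package**
(the weakening to realisable periods buys nothing once `RiemannRealisableAt` holds). [cite: Deligne1982HodgeCycles, §4 proof of Thm. 4.8] -/
theorem moduliCompletePackage_iff_periodPackage : ModuliCompletePackage ↔ PeriodPackage :=
  ⟨periodPackage_of_moduliCompletePackage, moduliCompletePackage_of_periodPackage⟩

/-- THE BRIDGE in `Theorems/` vocabulary (the skeleton's `hyperbolic_of_periodPackage`, same proof): hyperbolic members are of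
Weil type and lie in the split discriminant class `[(-1)ⁿ]`, so the period-surjective package gives the hyperbolic reach fact.
[cite: Deligne1982HodgeCycles, §4 Cor. 4.2, Prop. 4.4 and proof of Thm. 4.8] [cite: vanGeemen1994HodgeAV, Lemma 5.2 and (5.4.1)] -/
theorem weilFamilyReach_hyperbolic_of_periodPackage (h : PeriodPackage) : weilFamilyReach_hyperbolic := by
  intro n d hn hd P ψ₀ e a hP hψ ha ha0 hhyp w hw hw0 A φ eA aA hA hφ haA haA0 hhypA
  have hn0 : 0 < n := hn
  have hd0 : 0 < d := hd
  have hWP : IsWeilType P ψ₀ n d := isWeilType_of_isHyperbolicWeilType hn0 hd0 hP hψ e ha ha0 hhyp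
  have hWA : IsWeilType A φ n d := isWeilType_of_isHyperbolicWeilType hn0 hd0 hA hφ eA haA haA0 hhypA
  have hδP := hasWeilDiscriminantNondeg_neg_one_pow_of_isHyperbolicWeilType hn0 hP hd0 hψ e ha ha0 hhyp
  have hδA := hasWeilDiscriminantNondeg_neg_one_pow_of_isHyperbolicWeilType hn0 hA hd0 hφ eA haA haA0 hhypA
  obtain ⟨cP, hcPw, hcP0, -⟩ := exists_isRationalClass_ne_zero_mem_weilClassesOf hWP.pos hWP.dim_eq hWP.d_pos hWP.sq_eq
  obtain ⟨cA, hcAw, hcA0, -⟩ := exists_isRationalClass_ne_zero_mem_weilClassesOf hWA.pos hWA.dim_eq hWA.d_pos hWA.sq_eq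
  obtain ⟨𝒳, S, f, s₀, e', Y, Ψ, ε, H, hfam, hemb, hirr, hsm, hqp, hYΨ, hsec, hH, hH₀, hU⟩ :=
    h n d hn hd P ψ₀ e a hP ha ha0 hWP
  exact weilFamilyReaches_of_polarizedWeilSystemAt_of_periodSurjective hn hP e ha ha0
    ⟨cP, hcPw, hcP0, hWP.isOfHodgeType_of_mem_weilClassesOf hcPw⟩ hδP f e' Y Ψ ε hfam hemb hirr hsm hqp hYΨ hsec
    hH hH₀ hU hA hφ eA haA haA0 ⟨cA, hcAw, hcA0, hWA.isOfHodgeType_of_mem_weilClassesOf hcAw⟩ hδA hw hw0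

/-- Hence the crux fact from the moduli-complete package ALONE (Riemann half discharged). [cite: Deligne1982HodgeCycles, §4 proof of Thm. 4.8] -/
theorem weilFamilyReach_hyperbolic_of_moduliCompletePackage (hM : ModuliCompletePackage) : weilFamilyReach_hyperbolic :=
  weilFamilyReach_hyperbolic_of_periodPackage (periodPackage_of_moduliCompletePackage hM)

/-- **`stub_moduliComplete` ⟹ `Theses.EightfoldTwistedSheafSeeds.ReachHyperbolic` BY NAME** (the skeleton's composition
`ReachHyperbolic_of` with its Riemann stub discharged: the by-name closure of item 18883 is one `exact` away from a proof of
`ModuliCompletePackage`). [cite: Deligne1982HodgeCycles, §4 proof of Thm. 4.8] -/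
theorem reachHyperbolic_twisted_of_moduliCompletePackage (hM : ModuliCompletePackage) :
    Summit.HodgeConjecture.HodgeConjecture.Theses.EightfoldTwistedSheafSeeds.ReachHyperbolic :=
  weilFamilyReach_hyperbolic_of_moduliCompletePackage hM

/-- The same for the sibling route decl `Theses.EightfoldBlochSeeds.ReachHyperbolic` (both are `weilFamilyReach_hyperbolic`).
[cite: Deligne1982HodgeCycles, §4 proof of Thm. 4.8] -/
theorem reachHyperbolic_of_moduliCompletePackage (hM : ModuliCompletePackage) :
    Summit.HodgeConjecture.HodgeConjecture.Theses.EightfoldBlochSeeds.ReachHyperbolic :=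
  weilFamilyReach_hyperbolic_of_moduliCompletePackage hM


/-! ## Appended (same leafhand, same generation): the two other routes sharing item 18883 -/

/-- The same for the route decl `Theses.FirstOrderSemiregularSeeds.ReachHyperbolic` (also `weilFamilyReach_hyperbolic`; the item is
shared by four routes). [cite: Deligne1982HodgeCycles, §4 proof of Thm. 4.8] -/
theorem reachHyperbolic_firstOrder_of_moduliCompletePackage (hM : ModuliCompletePackage) :
    Summit.HodgeConjecture.HodgeConjecture.Theses.FirstOrderSemiregularSeeds.ReachHyperbolic :=
  weilFamilyReach_hyperbolic_of_moduliCompletePackage hM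

/-- The same for the route decl `Theses.CYFormCasimir.ReachHyperbolic`. [cite: Deligne1982HodgeCycles, §4 proof of Thm. 4.8] -/
theorem reachHyperbolic_cyFormCasimir_of_moduliCompletePackage (hM : ModuliCompletePackage) :
    Summit.HodgeConjecture.HodgeConjecture.Theses.CYFormCasimir.ReachHyperbolic :=
  weilFamilyReach_hyperbolic_of_moduliCompletePackage hM

end Summit.HodgeConjecture.HodgeConjecture.Theorems

end
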